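import Mathlib
import HarnessLib

/-!
# Route LiouvilleSarnak — crux `LiouvilleCutRank` (stmt-ValiantsHypothesis-14775):
# relabelling row bits and column bits does not change the cut rank

A cut `π : Fin n ⊕ Fin n ≃ Fin (2n)` determines the SETS of row and column positions together with a labelling
(which row bit sits at which row position).  The cut matrix of `π ∘ (σ ⊕ τ)` (`σ, τ` permutations of the row resp.
column bit labels) is the cut matrix of `π` with its rows and columns permuted, so the rank is the same.  Hence every
theorem of the route stated for one labelling of a cut shape (the "shape hypotheses"
`π (inl i) = p ⌊i/a⌋ + posR (i mod a)` of `…PeriodicDigits`, `…InterleavedUnbounded`, `…CcrrUnbounded`, …) holds for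
EVERY cut with the same row-position set.

* `cutMatrix_sumCongr_eq_submatrix` — `M_{(σ ⊕ τ) ≫ π} = M_π.submatrix (· ∘ σ⁻¹) (· ∘ τ⁻¹)`.
* ★ `rank_cutMatrix_sumCongr` — `rank M_{(σ ⊕ τ) ≫ π} = rank M_π`.
* `rank_cutMatrix_eq_of_range_inl_eq` — two cuts with the same SET of row positions have cut matrices of equal rank.

Honest framing: bookkeeping; `LiouvilleCutRank`, `DigitalBilinearLiouville`, `AlgebraicSarnak` stay OPEN; nothing
bears on `VP ≠ VNP`.  No definitions.
-/

set_option linter.dupNamespace false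

noncomputable section

namespace Summit.ValiantsHypothesis.ValiantsHypothesis.Theorems.LiouvilleSarnakLiouvilleCutRank.CutRelabel

open ArithmeticFunction Finset

/-- Relabelling row/column bits permutes rows/columns of the cut matrix. [folklore] -/
theorem cutMatrix_sumCongr_eq_submatrix (n : ℕ) (π : Fin n ⊕ Fin n ≃ Fin (2 * n))
    (σ τ : Equiv.Perm (Fin n)) :
    (Matrix.of fun r c : Fin n → Bool =>
      (((liouville (Nat.ofBits (fun k : Fin (2 * n) =>
        Sum.elim r c (((Equiv.sumCongr σ τ).trans π).symm k)) + 1) : ℤ) : ℂ))) =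
    (Matrix.of fun r c : Fin n → Bool =>
      (((liouville (Nat.ofBits (fun k : Fin (2 * n) => Sum.elim r c (π.symm k)) + 1) : ℤ) : ℂ))).submatrix
      (Equiv.arrowCongr σ (Equiv.refl Bool)) (Equiv.arrowCongr τ (Equiv.refl Bool)) := by
  ext r c
  simp only [Matrix.submatrix_apply, Matrix.of_apply]
  congr 3
  refine congrArg Nat.ofBits (funext fun k => ?_)
  simp only [Equiv.symm_trans_apply, Equiv.sumCongr_symm, Equiv.sumCongr_apply]
  rcases π.symm k with i | i
  · simp [Equiv.arrowCongr]
  · simp [Equiv.arrowCongr]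

/-- ★ Relabelling row/column bits does not change the rank of the cut matrix. [this file] -/
theorem rank_cutMatrix_sumCongr (n : ℕ) (π : Fin n ⊕ Fin n ≃ Fin (2 * n)) (σ τ : Equiv.Perm (Fin n)) :
    (Matrix.of fun r c : Fin n → Bool =>
      (((liouville (Nat.ofBits (fun k : Fin (2 * n) =>
        Sum.elim r c (((Equiv.sumCongr σ τ).trans π).symm k)) + 1) : ℤ) : ℂ))).rank =
    (Matrix.of fun r c : Fin n → Bool =>
      (((liouville (Nat.ofBits (fun k : Fin (2 * n) => Sum.elim r c (π.symm k)) + 1) : ℤ) : ℂ))).rank := by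
  rw [cutMatrix_sumCongr_eq_submatrix, Matrix.rank_submatrix]

/-- Two cuts with the same set of row positions differ by a relabelling `σ ⊕ τ`. [folklore] -/
theorem exists_sumCongr_of_range_inl_eq (n : ℕ) (π π' : Fin n ⊕ Fin n ≃ Fin (2 * n))
    (h : Set.range (fun i : Fin n => π (Sum.inl i)) = Set.range (fun i : Fin n => π' (Sum.inl i))) :
    ∃ σ τ : Equiv.Perm (Fin n), π' = (Equiv.sumCongr σ τ).trans π := by
  classical
  -- row labels: σ i := the row label of π at the position π' (inl i)
  have hrow : ∀ i : Fin n, ∃ j : Fin n, π (Sum.inl j) = π' (Sum.inl i) := fun i => by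
    have : π' (Sum.inl i) ∈ Set.range (fun i : Fin n => π (Sum.inl i)) := by rw [h]; exact ⟨i, rfl⟩
    obtain ⟨j, hj⟩ := this
    exact ⟨j, hj⟩
  -- column labels: the complement sets agree as well
  have hcol : ∀ i : Fin n, ∃ j : Fin n, π (Sum.inr j) = π' (Sum.inr i) := fun i => by
    rcases hk : π.symm (π' (Sum.inr i)) with j | j
    · exfalso
      have h1 : π (Sum.inl j) = π' (Sum.inr i) := by rw [← hk, Equiv.apply_symm_apply]
      have : π' (Sum.inr i) ∈ Set.range (fun i : Fin n => π' (Sum.inl i)) := by rw [← h]; exact ⟨j, h1⟩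
      obtain ⟨i', hi'⟩ := this
      exact absurd (π'.injective hi') (by simp)
    · exact ⟨j, by rw [← hk, Equiv.apply_symm_apply]⟩
  choose σf hσ using hrow
  choose τf hτ using hcol
  have hσinj : Function.Injective σf := fun a b hab => by
    have := hσ a; rw [hab, hσ b] at this; exact Sum.inl_injective (π'.injective this.symm)
  have hτinj : Function.Injective τf := fun a b hab => by
    have := hτ a; rw [hab, hτ b] at this; exact Sum.inr_injective (π'.injective this.symm)
  refine ⟨Equiv.ofBijective σf ⟨hσinj, Finite.injective_iff_surjective.mp hσinj⟩,
    Equiv.ofBijective τf ⟨hτinj, Finite.injective_iff_surjective.mp hτinj⟩, ?_⟩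
  refine Equiv.ext fun x => ?_
  rcases x with i | i
  · simp [hσ i]
  · simp [hτ i]

/-- ★ Two cuts with the same SET of row positions have cut matrices of the same rank. [this file] -/
theorem rank_cutMatrix_eq_of_range_inl_eq (n : ℕ) (π π' : Fin n ⊕ Fin n ≃ Fin (2 * n))
    (h : Set.range (fun i : Fin n => π (Sum.inl i)) = Set.range (fun i : Fin n => π' (Sum.inl i))) :
    (Matrix.of fun r c : Fin n → Bool =>
      (((liouville (Nat.ofBits (fun k : Fin (2 * n) => Sum.elim r c (π'.symm k)) + 1) : ℤ) : ℂ))).rank =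
    (Matrix.of fun r c : Fin n → Bool =>
      (((liouville (Nat.ofBits (fun k : Fin (2 * n) => Sum.elim r c (π.symm k)) + 1) : ℤ) : ℂ))).rank := by
  obtain ⟨σ, τ, rfl⟩ := exists_sumCongr_of_range_inl_eq n π π' h
  exact rank_cutMatrix_sumCongr n π σ τ

end Summit.ValiantsHypothesis.ValiantsHypothesis.Theorems.LiouvilleSarnakLiouvilleCutRank.CutRelabel

end
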